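import Summits.AtomisticToContinuum.Crystallization.Theorems.FreeSplittingCertificatesStrictSplittingRuleCoreDefsStar
import Summits.AtomisticToContinuum.Crystallization.Theorems.FreeSplittingCertificatesStrictSplittingRuleCoreFirstOrderDesignGeometry

/-!
# Finiteness of hcp index balls

Helper of reshape r5 (lead c5) of crux `StrictSplittingRule` (stmt-AtomisticToContinuum-12560), line `registered`:
toward the glue `H2N ∧ H2F ⇒ CoreStarCoercive` (near-field LMI + far-field Korn export ⇒ H2⋆). Registered stub, landed
`--supports stmt-AtomisticToContinuum-12560`.
-/

noncomputable section

namespace Summit.AtomisticToContinuum.Crystallization.Theorems.StrictSplittingRuleBirth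

open scoped BigOperators Classical
open Literature.MathematicalPhysics.StatisticalMechanics
open Literature.Geometry.DiscreteGeometry
open Summit.AtomisticToContinuum.Crystallization.Theorems.PalmUnimodularRigidity.LayeredLawsSelectHcp
  (hcpSite ljSqDeriv)

/-- Only finitely many hcp sites lie in any ball about the root site (`a, h > 0`): the summable family
`d ↦ (1 + ‖y_d‖)⁻⁴` (`h1_summable_one_add_inv_pow`) tends to `0` along the cofinite filter, while on the ball it is
bounded below by `(1 + max r 0)⁻⁴ > 0`. [folklore] -/
theorem finiteBall_root {a h : ℝ} (ha : 0 < a) (hh : 0 < h) (r : ℝ) :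
    Set.Finite {d : ℤ × ℤ × ℤ | ‖hcpSite a h d‖ ≤ r} := by
  have hs := h1_summable_one_add_inv_pow ha hh (n := 4) (by norm_num)
  have hε : (0 : ℝ) < ((1 + max r 0)⁻¹) ^ 4 := by positivity
  have hev := hs.tendsto_cofinite_zero.eventually_lt_const hε
  refine (Filter.eventually_cofinite.1 hev).subset fun d hd => ?_
  simp only [Set.mem_setOf_eq, not_lt] at hd ⊢
  have h1 : ‖hcpSite a h d‖ ≤ max r 0 := hd.trans (le_max_left r 0)
  have h2 : (0 : ℝ) < 1 + ‖hcpSite a h d‖ := by positivity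
  exact pow_le_pow_left₀ (by positivity) (inv_anti₀ h2 (by linarith)) 4

/-- **stub_finiteBall** (r5 helper, bookkeeping): only finitely many hcp sites lie within any distance `r` of a given
site (`a, h > 0`; e.g. from the summability of `Σ_d (1 + ‖y_d‖)⁻⁴` and covariance `h1_sub_eq`). [folklore] -/
theorem stub_finiteBall : ∀ a h : ℝ, 0 < a → 0 < h → ∀ (p : ℤ × ℤ × ℤ) (r : ℝ),
    Set.Finite {q : ℤ × ℤ × ℤ | ‖hcpSite a h q - hcpSite a h p‖ ≤ r} := by
  intro a h ha hh p r
  have hS := finiteBall_root ha hh r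
  have hT : Set.Finite (Neg.neg ⁻¹' {d : ℤ × ℤ × ℤ | ‖hcpSite a h d‖ ≤ r}) :=
    hS.preimage neg_injective.injOn
  refine ((hS.union hT).image fun d => p + d).subset fun q hq => ?_
  refine ⟨q - p, ?_, add_sub_cancel p q⟩
  have he := h1_sub_eq a h p (q - p)
  rw [add_sub_cancel] at he
  simp only [Set.mem_setOf_eq] at hq
  rw [he] at hq
  split_ifs at hq with hp
  · exact Or.inl hq
  · exact Or.inr (by simpa only [Set.mem_preimage, Set.mem_setOf_eq, norm_neg] using hq)

end Summit.AtomisticToContinuum.Crystallization.Theorems.StrictSplittingRuleBirth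

end
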